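import Summits.Ventures.DiscreteObjects.MOLS.NetCompletion

/-!
# Nets of deficiency two: the unjoined graph has the parameters of the lattice graph `L₂(n)` (kernel)
Framing: lottery ticket; floor = certified bounds/negative ranges.

Cell pub-namedobj (venture DiscreteObjects), target (M), designs gen 9.  Counting lemmas for the net of `n - 3` pairwise orthogonal
Latin squares of order `n` (parallel classes: rows, columns, the squares; `|classes| = n - 1`, deficiency two), in the coordinates
`coord` / `JE` (joined-or-equal) of `NetCompletion`.  With `U p` the set of cells unjoined to `p`:
* `card_U_filter_line` — a line not through `p` carries exactly 2 cells unjoined to `p`; `card_U` — `|U p| = 2(n - 1)`;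
* `card_commonJoined_of_unjoined` / `card_commonJoined_of_joined` — the cells joined to both `p` and `q` are in bijection with
  ordered pairs of distinct classes (resp. plus the line `pq`), so number `(n-1)(n-2)` (resp. `n + (n-2)(n-3)`);
* **`card_U_inter_of_unjoined`** — unjoined `p, q` have exactly `n - 2` common unjoined cells; **`card_U_inter_of_joined`** —
  joined `p ≠ q` have exactly `2`.
That is, the unjoined graph is strongly regular with the parameters `(n², 2(n-1), n-2, 2)` of `L₂(n)` (Bruck 1963 §2, the
pseudo-net graph of degree 2); `NetCompletionTwo` runs Shrikhande's argument on it.  Classical; formalisation ours; no `sorry`.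
-/

namespace Summit.Ventures.DiscreteObjects.MOLS

open Function Finset Literature.Combinatorics.Designs.LatinSquares
open scoped Classical

section Counts

variable {ι : Type*} {n : ℕ} {Ls : ι → Fin n → Fin n → Fin n}

/-- `JE` is reflexive -/
theorem JE_refl (p : Fin n × Fin n) : JE Ls p p := ⟨Sum.inr false, rfl⟩

/-- `JE` is symmetric -/
theorem JE_comm {p q : Fin n × Fin n} : JE Ls p q ↔ JE Ls q p :=
  ⟨fun ⟨c, hc⟩ => ⟨c, hc.symm⟩, fun ⟨c, hc⟩ => ⟨c, hc.symm⟩⟩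

/-- the cells unjoined to `p` (the neighbourhood of `p` in the unjoined graph) -/
noncomputable def U (Ls : ι → Fin n → Fin n → Fin n) (p : Fin n × Fin n) : Finset (Fin n × Fin n) :=
  univ.filter fun x => ¬ JE Ls p x

/-- membership in `U p` -/
theorem mem_U {p x : Fin n × Fin n} : x ∈ U Ls p ↔ ¬ JE Ls p x := by simp [U]

/-- `p ∉ U p` -/
theorem not_mem_U_self (p : Fin n × Fin n) : p ∉ U Ls p := fun h => mem_U.mp h (JE_refl p)

/-- unjoinedness is symmetric -/
theorem mem_U_comm {p q : Fin n × Fin n} : q ∈ U Ls p ↔ p ∈ U Ls q := by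
  rw [mem_U, mem_U, JE_comm]

/-- the cells joined (or equal) to `p` -/
noncomputable def JEset (Ls : ι → Fin n → Fin n → Fin n) (p : Fin n × Fin n) : Finset (Fin n × Fin n) :=
  univ.filter fun x => JE Ls p x

/-- membership in `JEset p` -/
theorem mem_JEset {p x : Fin n × Fin n} : x ∈ JEset Ls p ↔ JE Ls p x := by simp [JEset]

/-- `U p` is the complement of `JEset p` -/
theorem U_eq_compl (p : Fin n × Fin n) : U Ls p = (JEset Ls p)ᶜ := by
  ext x; simp [U, JEset]

/-- no cell of `p`'s own line is unjoined to `p` -/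
theorem U_filter_line_self (p : Fin n × Fin n) (c : ι ⊕ Bool) :
    ((U Ls p).filter fun x => coord Ls c x = coord Ls c p) = ∅ := by
  ext x
  simp only [U, mem_filter, mem_univ, true_and, JE, not_exists, Finset.notMem_empty, iff_false, not_and]
  intro h
  exact fun e => h c e

variable (hL : ∀ k, IsLatinSquare (Ls k)) (hO : ∀ k k', k ≠ k' → IsOrthogonalMate (Ls k) (Ls k'))
include hL hO

/-- two distinct cells are joined through at most one class -/
theorem class_unique {p x : Fin n × Fin n} (hpx : p ≠ x) {c c' : ι ⊕ Bool} (hc : coord Ls c x = coord Ls c p)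
    (hc' : coord Ls c' x = coord Ls c' p) : c = c' := by
  by_contra hcc
  exact hpx (eq_of_coord_eq hL hO hcc hc.symm hc'.symm)

/-- the cell agreeing with `p` in class `c` and with `q` in class `c' ≠ c` -/
theorem exists_pt (p q : Fin n × Fin n) {c c' : ι ⊕ Bool} (hcc : c ≠ c') :
    ∃ x : Fin n × Fin n, coord Ls c x = coord Ls c p ∧ coord Ls c' x = coord Ls c' q :=
  coord_pair_surjective hL hO hcc _ _

variable [Fintype ι]

/-- **a line not through `p` carries exactly two cells unjoined to `p`** (deficiency two: `|ι| + 3 = n`) -/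
theorem card_U_filter_line (hC : Fintype.card ι + 3 = n) (p : Fin n × Fin n) {c : ι ⊕ Bool} {s : Fin n}
    (hs : coord Ls c p ≠ s) : ((U Ls p).filter fun x => coord Ls c x = s).card = 2 := by
  have h1 := card_filter_add_card_filter_not (s := univ.filter fun x : Fin n × Fin n => coord Ls c x = s)
    (fun x => JE Ls p x)
  rw [card_joined_on_line hL hO p hs, card_line hL hO, Fintype.card_sum, Fintype.card_bool] at h1
  have h2 : ((U Ls p).filter fun x => coord Ls c x = s) =
      (univ.filter fun x : Fin n × Fin n => coord Ls c x = s).filter fun x => ¬ JE Ls p x := by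
    ext x; simp [U, and_comm]
  rw [h2]
  omega

/-- **`|U p| = 2(n - 1)`** -/
theorem card_U (hC : Fintype.card ι + 3 = n) (p : Fin n × Fin n) : (U Ls p).card = 2 * (n - 1) := by
  rw [card_eq_sum_card_fiberwise (f := coord Ls (Sum.inr false)) (t := univ) (fun _ _ => mem_univ _)]
  rw [← Finset.sum_erase_add _ _ (mem_univ (coord Ls (Sum.inr false) p)), U_filter_line_self, card_empty, add_zero]
  rw [Finset.sum_congr rfl fun s hs => card_U_filter_line hL hO hC p (Ne.symm (ne_of_mem_erase hs))]
  rw [sum_const, card_erase_of_mem (mem_univ _), card_univ, Fintype.card_fin, smul_eq_mul, mul_comm]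

/-- `|JEset p| + 2(n-1) = n²` -/
theorem card_JEset (hC : Fintype.card ι + 3 = n) (p : Fin n × Fin n) : (JEset Ls p).card + 2 * (n - 1) = n * n := by
  have h := card_compl (JEset Ls p)
  rw [← U_eq_compl, card_U hL hO hC, Fintype.card_prod, Fintype.card_fin] at h
  have h' : (U Ls p).card ≤ n * n := by
    have := card_le_univ (U Ls p); rwa [Fintype.card_prod, Fintype.card_fin] at this
  rw [card_U hL hO hC] at h'
  omega

/-- **cells joined to both of two unjoined cells ↔ ordered pairs of distinct classes:** their number is `|C|(|C|-1)`. -/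
theorem card_commonJoined_of_unjoined {p q : Fin n × Fin n} (hpq : ¬ JE Ls p q) :
    (JEset Ls p ∩ JEset Ls q).card = Fintype.card (ι ⊕ Bool) * Fintype.card (ι ⊕ Bool) - Fintype.card (ι ⊕ Bool) := by
  let φ : (ι ⊕ Bool) × (ι ⊕ Bool) → Fin n × Fin n := fun cc =>
    if h : cc.1 ≠ cc.2 then Classical.choose (exists_pt hL hO p q h) else p
  have hφ : ∀ {cc : (ι ⊕ Bool) × (ι ⊕ Bool)}, cc.1 ≠ cc.2 →
      coord Ls cc.1 (φ cc) = coord Ls cc.1 p ∧ coord Ls cc.2 (φ cc) = coord Ls cc.2 q := by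
    intro cc hcc
    simp only [φ, hcc, ne_eq, not_false_eq_true, dif_pos]
    exact Classical.choose_spec (exists_pt hL hO p q hcc)
  have heq : JEset Ls p ∩ JEset Ls q = (univ : Finset (ι ⊕ Bool)).offDiag.image φ := by
    ext x
    simp only [mem_inter, mem_JEset, JE, mem_image, mem_offDiag, mem_univ, true_and]
    constructor
    · rintro ⟨⟨c, hc⟩, ⟨c', hc'⟩⟩
      have hcc : c ≠ c' := by rintro rfl; exact hpq ⟨c, hc'.symm.trans hc⟩
      refine ⟨(c, c'), hcc, ?_⟩
      obtain ⟨h1, h2⟩ := hφ (cc := (c, c')) hcc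
      exact eq_of_coord_eq hL hO hcc (h1.trans hc.symm) (h2.trans hc'.symm)
    · rintro ⟨cc, hcc, rfl⟩
      obtain ⟨h1, h2⟩ := hφ hcc
      exact ⟨⟨cc.1, h1⟩, ⟨cc.2, h2⟩⟩
  have hinj : Set.InjOn φ ↑((univ : Finset (ι ⊕ Bool)).offDiag) := by
    rintro ⟨c, c'⟩ hcc ⟨e, e'⟩ hee h
    simp only [coe_offDiag, Set.mem_offDiag, coe_univ, Set.mem_univ, true_and] at hcc hee
    obtain ⟨h1, h2⟩ := hφ (cc := (c, c')) hcc
    obtain ⟨h3, h4⟩ := hφ (cc := (e, e')) hee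
    simp only at h1 h2 h3 h4
    rw [h] at h1 h2
    have hce : c = e := by
      by_contra hce
      have hx : φ (e, e') = p := eq_of_coord_eq hL hO hce h1 h3
      rw [hx] at h4
      exact hpq ⟨e', h4.symm⟩
    have hce' : c' = e' := by
      by_contra hce'
      have hx : φ (e, e') = q := eq_of_coord_eq hL hO hce' h2 h4
      rw [hx] at h3
      exact hpq ⟨e, h3⟩
    rw [hce, hce']
  rw [heq, card_image_of_injOn hinj, offDiag_card, card_univ]

/-- **Unjoined `p, q` have exactly `n - 2` common unjoined cells** (`λ` of the pseudo-`L₂(n)` graph). -/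
theorem card_U_inter_of_unjoined (hC : Fintype.card ι + 3 = n) {p q : Fin n × Fin n} (hpq : ¬ JE Ls p q) :
    (U Ls p ∩ U Ls q).card + 2 = n := by
  have h1 : U Ls p ∩ U Ls q = (JEset Ls p ∪ JEset Ls q)ᶜ := by
    rw [U_eq_compl, U_eq_compl, ← compl_union]
  have h2 := card_compl (JEset Ls p ∪ JEset Ls q)
  rw [Fintype.card_prod, Fintype.card_fin] at h2
  have h3 := card_union_add_card_inter (JEset Ls p) (JEset Ls q)
  have h4 := card_commonJoined_of_unjoined hL hO hpq
  rw [Fintype.card_sum, Fintype.card_bool] at h4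
  have h5 := card_JEset hL hO hC p
  have h6 := card_JEset hL hO hC q
  have h7 : (JEset Ls p ∪ JEset Ls q).card ≤ n * n := by
    have := card_le_univ (JEset Ls p ∪ JEset Ls q); rwa [Fintype.card_prod, Fintype.card_fin] at this
  rw [h1, h2]
  obtain ⟨k, rfl⟩ : ∃ k, n = k + 3 := ⟨Fintype.card ι, hC.symm⟩
  have hι : Fintype.card ι = k := by omega
  rw [hι] at h4
  have e1 : (k + 2) * (k + 2) - (k + 2) = k * k + 3 * k + 2 := by
    have : (k + 2) * (k + 2) = (k * k + 3 * k + 2) + (k + 2) := by ring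
    rw [this]; omega
  rw [e1] at h4
  have e2 : (k + 3) * (k + 3) = k * k + 6 * k + 9 := by ring
  rw [e2] at h2 h5 h6 h7 ⊢
  generalize k * k = K at *
  omega

/-- **cells joined to both of two distinct joined cells:** the `n` cells of their line plus one for each ordered pair of
distinct classes other than the line's class; number `n + (|C|-1)(|C|-2)`. -/
theorem card_commonJoined_of_joined (hC : Fintype.card ι + 3 = n) {p q : Fin n × Fin n} (hne : p ≠ q) {c₀ : ι ⊕ Bool}
    (h0 : coord Ls c₀ q = coord Ls c₀ p) :
    (JEset Ls p ∩ JEset Ls q).card = n + (n - 2) * (n - 3) := by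
  -- split along the line ℓ = (c₀, coord c₀ p)
  set ℓ : Finset (Fin n × Fin n) := univ.filter fun x => coord Ls c₀ x = coord Ls c₀ p with hℓ
  have hsplit := card_filter_add_card_filter_not (s := JEset Ls p ∩ JEset Ls q) (fun x => coord Ls c₀ x = coord Ls c₀ p)
  -- on the line: all `n` cells are joined to both
  have hon : ((JEset Ls p ∩ JEset Ls q).filter fun x => coord Ls c₀ x = coord Ls c₀ p) = ℓ := by
    ext x
    simp only [mem_filter, mem_inter, mem_JEset, JE, mem_univ, true_and, hℓ]
    constructor
    · exact fun h => h.2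
    · intro hx; exact ⟨⟨⟨c₀, hx⟩, ⟨c₀, hx.trans h0.symm⟩⟩, hx⟩
  -- off the line: bijection with ordered pairs of distinct classes ≠ c₀
  let D : Finset ((ι ⊕ Bool) × (ι ⊕ Bool)) := (univ.erase c₀).offDiag
  let φ : (ι ⊕ Bool) × (ι ⊕ Bool) → Fin n × Fin n := fun cc =>
    if h : cc.1 ≠ cc.2 then Classical.choose (exists_pt hL hO p q h) else p
  have hφ : ∀ {cc : (ι ⊕ Bool) × (ι ⊕ Bool)}, cc.1 ≠ cc.2 →
      coord Ls cc.1 (φ cc) = coord Ls cc.1 p ∧ coord Ls cc.2 (φ cc) = coord Ls cc.2 q := by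
    intro cc hcc
    simp only [φ, hcc, ne_eq, not_false_eq_true, dif_pos]
    exact Classical.choose_spec (exists_pt hL hO p q hcc)
  have hmemD : ∀ {cc : (ι ⊕ Bool) × (ι ⊕ Bool)}, cc ∈ D ↔ cc.1 ≠ c₀ ∧ cc.2 ≠ c₀ ∧ cc.1 ≠ cc.2 := by
    intro cc; simp [D, mem_offDiag]
  have hoff : ((JEset Ls p ∩ JEset Ls q).filter fun x => ¬ coord Ls c₀ x = coord Ls c₀ p) = D.image φ := by
    ext x
    simp only [mem_filter, mem_inter, mem_JEset, JE, mem_image]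
    constructor
    · rintro ⟨⟨⟨c, hc⟩, ⟨c', hc'⟩⟩, hx⟩
      have hc0 : c ≠ c₀ := by rintro rfl; exact hx hc
      have hc'0 : c' ≠ c₀ := by rintro rfl; exact hx (hc'.trans h0)
      have hcc : c ≠ c' := by
        rintro rfl
        exact hne (eq_of_coord_eq hL hO hc0 (hc.symm.trans hc') h0.symm)
      refine ⟨(c, c'), hmemD.mpr ⟨hc0, hc'0, hcc⟩, ?_⟩
      obtain ⟨h1, h2⟩ := hφ (cc := (c, c')) hcc
      exact eq_of_coord_eq hL hO hcc (h1.trans hc.symm) (h2.trans hc'.symm)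
    · rintro ⟨cc, hcc, rfl⟩
      obtain ⟨h10, h20, h12⟩ := hmemD.mp hcc
      obtain ⟨h1, h2⟩ := hφ h12
      refine ⟨⟨⟨cc.1, h1⟩, ⟨cc.2, h2⟩⟩, fun hx => ?_⟩
      -- on the line and agreeing with p in class cc.1 ≠ c₀ forces φ cc = p, then p agrees with q in cc.2 and c₀
      have e1 : φ cc = p := eq_of_coord_eq hL hO h10 h1 hx
      rw [e1] at h2
      exact hne (eq_of_coord_eq hL hO h20 h2 h0.symm)
  have hinj : Set.InjOn φ ↑D := by
    rintro ⟨c, c'⟩ hcc ⟨e, e'⟩ hee h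
    obtain ⟨hc0, hc'0, hcc'⟩ := hmemD.mp (Finset.mem_coe.mp hcc)
    obtain ⟨he0, he'0, hee'⟩ := hmemD.mp (Finset.mem_coe.mp hee)
    obtain ⟨h1, h2⟩ := hφ (cc := (c, c')) hcc'
    obtain ⟨h3, h4⟩ := hφ (cc := (e, e')) hee'
    simp only at h1 h2 h3 h4 hc0 hc'0 he0 he'0
    rw [h] at h1 h2
    have hce : c = e := by
      by_contra hce
      have hx : φ (e, e') = p := eq_of_coord_eq hL hO hce h1 h3
      rw [hx] at h4
      exact hne (eq_of_coord_eq hL hO he'0 h4 h0.symm)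
    have hce' : c' = e' := by
      by_contra hce'
      have hx : φ (e, e') = q := eq_of_coord_eq hL hO hce' h2 h4
      rw [hx] at h3
      exact hne (eq_of_coord_eq hL hO he0 h3.symm h0.symm)
    rw [hce, hce']
  rw [hon, hoff, card_image_of_injOn hinj, card_line hL hO] at hsplit
  have hD : D.card = (n - 2) * (n - 3) := by
    simp only [D, offDiag_card, card_erase_of_mem (mem_univ _), card_univ, Fintype.card_sum, Fintype.card_bool]
    obtain ⟨k, rfl⟩ : ∃ k, n = k + 3 := ⟨Fintype.card ι, hC.symm⟩
    have hι : Fintype.card ι = k := by omega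
    rw [hι, show k + 2 - 1 = k + 1 by omega, show k + 3 - 2 = k + 1 by omega, show k + 3 - 3 = k by omega]
    have : (k + 1) * (k + 1) = (k + 1) * k + (k + 1) := by ring
    rw [this]; omega
  rw [hD] at hsplit
  exact hsplit.symm

/-- **Distinct joined `p, q` have exactly `2` common unjoined cells** (`μ` of the pseudo-`L₂(n)` graph). -/
theorem card_U_inter_of_joined (hC : Fintype.card ι + 3 = n) {p q : Fin n × Fin n} (hne : p ≠ q) (hpq : JE Ls p q) :
    (U Ls p ∩ U Ls q).card = 2 := by
  obtain ⟨c₀, h0⟩ := hpq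
  have h1 : U Ls p ∩ U Ls q = (JEset Ls p ∪ JEset Ls q)ᶜ := by
    rw [U_eq_compl, U_eq_compl, ← compl_union]
  have h2 := card_compl (JEset Ls p ∪ JEset Ls q)
  rw [Fintype.card_prod, Fintype.card_fin] at h2
  have h3 := card_union_add_card_inter (JEset Ls p) (JEset Ls q)
  have h4 := card_commonJoined_of_joined hL hO hC hne h0
  have h5 := card_JEset hL hO hC p
  have h6 := card_JEset hL hO hC q
  have h7 : (JEset Ls p ∪ JEset Ls q).card ≤ n * n := by
    have := card_le_univ (JEset Ls p ∪ JEset Ls q); rwa [Fintype.card_prod, Fintype.card_fin] at this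
  rw [h1, h2]
  obtain ⟨k, rfl⟩ : ∃ k, n = k + 3 := ⟨Fintype.card ι, hC.symm⟩
  have e1 : k + 3 + (k + 3 - 2) * (k + 3 - 3) = k * k + 2 * k + 3 := by
    rw [show k + 3 - 2 = k + 1 by omega, show k + 3 - 3 = k by omega]; ring
  rw [e1] at h4
  have e2 : (k + 3) * (k + 3) = k * k + 6 * k + 9 := by ring
  rw [e2] at h2 h5 h6 h7 ⊢
  generalize k * k = K at *
  omega

end Counts

end Summit.Ventures.DiscreteObjects.MOLS
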